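import Mathlib.Topology.Order.IntermediateValue
import Summits.AnomalousDissipation.AnomalousDissipation.Theorems.SawtoothPulseCascadeK1LocalisedCascadeSymbolFibreTools

/-!
# K1loc, line `Spectral` / SeqCone — helper: H-FIBRE AND ENVELOPE TAYLOR DATA OF THE CONCRETE SYMBOLS (S-B symbol data)

Helper file of the prover lane on the crux `K1LocalisedCascade` (stmt-AnomalousDissipation-19491), route
`SawtoothPulseCascade` (memo v6 §2 / addendum §C; glue seat k1loc-p3).  Companion of `…SymbolFibreDataV`: on the H half-slot
the fibres are `k_h = n` and the fibre coordinate is `t = k_v`.  For the concrete symbols of `…SymbolLattice` the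
max-compatibility step needs smoothness and all-orders sup bounds of
* the OLD symbol `μ_H(t) = 1 − g^S_L(n, t) = 1 − sT((|n| − L)/(εL))·(1 − sT((γ|t| − a|n|)/(ε_aL)))`;
* the squared shifted NEW symbol
  `ν_H(t) = (1 − g^M_{L₀}(n, t − b))² = (1 − sT((|n| − L₀)/(εL₀))·(1 − sT((γ|t − b + γn| − a₂|n|)/(ε_aL₀))·sT((γ|t − b − γn| − a₂|n|)/(ε_aL₀))))²`;
* the envelope profiles `μ_env(t) = 1 − (1 − sT((|n| − R)/w))·(1 − sT((|t| − R)/w))` and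
  `ν_env(t) = (1 − (1 − sT((|n| − R)/w))·(1 − sT((|t − b| − R)/w)))²` (either fibre direction).
All are, near each point, of the shape `1 − sT(p₁ + q₁t)·(1 − sT(p₂ + q₂t)·sT(p₃ + q₃t))` (a constant `c ∈ [0,1]` is
`sT(p)` for some `p`, `exists_smoothTransition_eq`), so `…SymbolFibreTools` gives `C_r/bʳ` bounds with `C_r` depending on
`r` only: `exists_bound_iteratedDeriv_symS_fibreH` (`b·γ ≤ ε_aL`), `exists_bound_iteratedDeriv_symM_fibreH_sq`
(`b·γ ≤ ε_aL₀`), `exists_bound_iteratedDeriv_symEnv_fibre` / `_sq` (`b ≤ w`), with the smoothness statements.  No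
definitions; no statement about the stub.  [cite: Grafakos2014, Prop. 3.1.2 (5)] [problem: turb]
-/

-- `Summit.<Summit>.<Problem>`: single-conjunct summit, the duplicate namespace segment is deliberate.
set_option linter.dupNamespace false

noncomputable section

namespace Summit.AnomalousDissipation.AnomalousDissipation.Theorems.SawtoothPulseCascade.K1Cutoff

open Set Filter Topology Real
open scoped ContDiff

/-- Every `c ∈ [0,1]` is a value of the smooth transition: `∃ p, sT p = c` (intermediate value theorem; used to put
constant factors into the affine-step class). [folklore] -/
theorem exists_smoothTransition_eq {c : ℝ} (h0 : 0 ≤ c) (h1 : c ≤ 1) : ∃ p : ℝ, smoothTransition p = c := by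
  have h := intermediate_value_Icc (zero_le_one (α := ℝ)) Real.smoothTransition.continuous.continuousOn
  rw [Real.smoothTransition.zero, Real.smoothTransition.one] at h
  obtain ⟨p, -, hp⟩ := h ⟨h0, h1⟩
  exact ⟨p, hp⟩

/-- `|q| ≤ N/D`, `b·N ≤ D` (`D > 0`, `b ≥ 0`) give `|q|·b ≤ 1`. [folklore] -/
theorem abs_mul_le_one_of_le_div' {q b N D : ℝ} (hD : 0 < D) (hq : |q| ≤ N / D) (hb : 0 ≤ b) (h : b * N ≤ D) :
    |q| * b ≤ 1 :=
  calc |q| * b ≤ N / D * b := mul_le_mul_of_nonneg_right hq hb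
    _ = b * N / D := by ring
    _ ≤ 1 := (div_le_one hD).mpr h

/-! ## The old start-of-phase symbol along an H-fibre: `μ_H(t) = 1 − g^S(n, t)` -/

/-- **Local form of `μ_H`** (`ε_a, L, a > 0`, `n ≠ 0`): near every `x`, `μ_H` has the shape
`1 − sT(p₁ + 0·t)·(1 − sT(p₂ + q₂t)·sT(1 + 0·t))` with `|q₂| ≤ |γ|/(ε_aL)`. [folklore] -/
theorem symS_fibreH_locally {γ ε εa a L : ℝ} (hεa : 0 < εa) (hL : 0 < L) (ha : 0 < a) {n : ℝ} (hn : n ≠ 0) (x : ℝ) :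
    ∃ p₂ q₂ : ℝ, |q₂| ≤ |γ| / (εa * L) ∧
      ((fun t : ℝ => 1 - smoothTransition ((|n| - L) / (ε * L)) *
        (1 - smoothTransition ((γ * |t| - a * |n|) / (εa * L)))) =ᶠ[𝓝 x]
        fun t => 1 - smoothTransition ((|n| - L) / (ε * L) + 0 * t) *
          (1 - smoothTransition (p₂ + q₂ * t) * smoothTransition (1 + 0 * t))) := by
  obtain ⟨p₂, q₂, hq₂, h₂⟩ := shiftStep_locally_affine (γ := γ) (t₀ := 0) (x := x) (mul_pos hεa hL)
    (mul_pos ha (abs_pos.mpr hn))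
  refine ⟨p₂, q₂, hq₂, ?_⟩
  filter_upwards [h₂] with t ht₂
  rw [sub_zero] at ht₂
  rw [ht₂, zero_mul, add_zero, add_zero, Real.smoothTransition.one, mul_one]

/-- **`μ_H` is smooth** (`ε_a, L, a > 0`; for `n = 0` the profile is the constant `1`). [folklore] -/
theorem contDiff_symS_fibreH {γ ε εa a L : ℝ} (hε : 0 < ε) (hεa : 0 < εa) (hL : 0 < L) (ha : 0 < a) (n : ℝ) {m : ℕ∞} :
    ContDiff ℝ m (fun t : ℝ => 1 - smoothTransition ((|n| - L) / (ε * L)) *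
        (1 - smoothTransition ((γ * |t| - a * |n|) / (εa * L)))) := by
  rcases eq_or_ne n 0 with rfl | hn
  · have h0 : smoothTransition ((|(0 : ℝ)| - L) / (ε * L)) = 0 :=
      Real.smoothTransition.zero_of_nonpos (div_nonpos_of_nonpos_of_nonneg (by rw [abs_zero]; linarith) (mul_pos hε hL).le)
    simp only [h0, zero_mul, sub_zero]
    exact contDiff_const
  · refine contDiff_iff_contDiffAt.2 fun x => ?_
    obtain ⟨p₂, q₂, -, h⟩ := symS_fibreH_locally (γ := γ) (ε := ε) hεa hL ha hn x
    exact ((contDiff_oneSubMulOneSubMul _ 0 p₂ q₂ 1 0).of_le (by exact_mod_cast le_top)).contDiffAt.congr_of_eventuallyEq h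

/-- **All-orders Taylor data of `μ_H`** (hypothesis `hL` of `symbol_taylor_hT` / bounds `hMα` on an H half-slot): for every
`r` there is `C_r ≥ 0` such that for all `ε, ε_a, a, L > 0`, `γ ≥ 0`, `0 < b` with `b·γ ≤ ε_aL`, all `n ∈ ℤ` and all `t`:
`|μ_H⁽ʳ⁾(t)| ≤ C_r/bʳ`. [cite: Grafakos2014, Prop. 3.1.2 (5)] -/
theorem exists_bound_iteratedDeriv_symS_fibreH (r : ℕ) :
    ∃ C : ℝ, 0 ≤ C ∧ ∀ {γ ε εa a L b : ℝ}, 0 ≤ γ → 0 < ε → 0 < εa → 0 < a → 0 < L → 0 < b → b * γ ≤ εa * L →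
      ∀ (n : ℤ) (x : ℝ), |iteratedDeriv r (fun t : ℝ => 1 - smoothTransition ((|(n : ℝ)| - L) / (ε * L)) *
        (1 - smoothTransition ((γ * |t| - a * |(n : ℝ)|) / (εa * L)))) x| ≤ C / b ^ r := by
  obtain ⟨C, hC0, hC⟩ := exists_bound_iteratedDeriv_oneSubMulOneSubMul r
  refine ⟨C + 1, by linarith, ?_⟩
  intro γ ε εa a L b hγ hε hεa ha hL hb hb₁ n x
  have hmono : C / b ^ r ≤ (C + 1) / b ^ r := div_le_div_of_nonneg_right (by linarith) (pow_pos hb r).le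
  rcases eq_or_ne (n : ℝ) 0 with hn | hn
  · have h0 : smoothTransition ((|(n : ℝ)| - L) / (ε * L)) = 0 :=
      Real.smoothTransition.zero_of_nonpos (div_nonpos_of_nonpos_of_nonneg (by rw [hn, abs_zero]; linarith)
        (mul_pos hε hL).le)
    simp only [h0, zero_mul, sub_zero, iteratedDeriv_const]
    split_ifs with hr
    · subst hr; rw [pow_zero, div_one, abs_one]; linarith
    · rw [abs_zero]; positivity
  · obtain ⟨p₂, q₂, hq₂, h⟩ := symS_fibreH_locally (γ := γ) (ε := ε) hεa hL ha hn x
    rw [h.iteratedDeriv_eq]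
    refine (hC hb ?_ ?_ ?_ x).trans hmono
    · rw [abs_zero, zero_mul]; exact zero_le_one
    · exact abs_mul_le_one_of_le_div' (mul_pos hεa hL) hq₂ hb.le (by rwa [abs_of_nonneg hγ])
    · rw [abs_zero, zero_mul]; exact zero_le_one

/-! ## The new mid-phase symbol along an H-fibre, squared and shifted: `ν_H(t) = (1 − g^M(n, t − b))²` -/

/-- **Local form of the inner profile `1 − g^M(n, t − b)`** (`ε_a, L₀, a₂ > 0`, `n ≠ 0`): near every `x` it has the shape
`1 − sT(p₁ + 0·t)·(1 − sT(p₂ + q₂t)·sT(p₃ + q₃t))` with `|q₂|, |q₃| ≤ |γ|/(ε_aL₀)`. [folklore] -/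
theorem symM_fibreH_locally {γ ε εa a₂ L₀ : ℝ} (hεa : 0 < εa) (hL₀ : 0 < L₀) (ha₂ : 0 < a₂) {n : ℝ} (hn : n ≠ 0)
    (b x : ℝ) :
    ∃ p₂ q₂ p₃ q₃ : ℝ, |q₂| ≤ |γ| / (εa * L₀) ∧ |q₃| ≤ |γ| / (εa * L₀) ∧
      ((fun t : ℝ => 1 - smoothTransition ((|n| - L₀) / (ε * L₀)) *
        (1 - smoothTransition ((γ * |t - b + γ * n| - a₂ * |n|) / (εa * L₀)) *
          smoothTransition ((γ * |t - b - γ * n| - a₂ * |n|) / (εa * L₀)))) =ᶠ[𝓝 x]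
        fun t => 1 - smoothTransition ((|n| - L₀) / (ε * L₀) + 0 * t) *
          (1 - smoothTransition (p₂ + q₂ * t) * smoothTransition (p₃ + q₃ * t))) := by
  have hκ : 0 < a₂ * |n| := mul_pos ha₂ (abs_pos.mpr hn)
  obtain ⟨p₂, q₂, hq₂, h₂⟩ := shiftStep_locally_affine (γ := γ) (t₀ := b - γ * n) (x := x) (mul_pos hεa hL₀) hκ
  obtain ⟨p₃, q₃, hq₃, h₃⟩ := shiftStep_locally_affine (γ := γ) (t₀ := b + γ * n) (x := x) (mul_pos hεa hL₀) hκ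
  refine ⟨p₂, q₂, p₃, q₃, hq₂, hq₃, ?_⟩
  filter_upwards [h₂, h₃] with t ht₂ ht₃
  rw [show t - b + γ * n = t - (b - γ * n) by ring, show t - b - γ * n = t - (b + γ * n) by ring, ht₂, ht₃, zero_mul,
    add_zero]

/-- **The inner profile `1 − g^M(n, · − b)` is smooth** (`ε, ε_a, L₀, a₂ > 0`). [folklore] -/
theorem contDiff_symM_fibreH {γ ε εa a₂ L₀ : ℝ} (hε : 0 < ε) (hεa : 0 < εa) (hL₀ : 0 < L₀) (ha₂ : 0 < a₂) (n b : ℝ)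
    {m : ℕ∞} :
    ContDiff ℝ m (fun t : ℝ => 1 - smoothTransition ((|n| - L₀) / (ε * L₀)) *
        (1 - smoothTransition ((γ * |t - b + γ * n| - a₂ * |n|) / (εa * L₀)) *
          smoothTransition ((γ * |t - b - γ * n| - a₂ * |n|) / (εa * L₀)))) := by
  rcases eq_or_ne n 0 with rfl | hn
  · have h0 : smoothTransition ((|(0 : ℝ)| - L₀) / (ε * L₀)) = 0 :=
      Real.smoothTransition.zero_of_nonpos (div_nonpos_of_nonpos_of_nonneg (by rw [abs_zero]; linarith)
        (mul_pos hε hL₀).le)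
    simp only [h0, zero_mul, sub_zero]
    exact contDiff_const
  · refine contDiff_iff_contDiffAt.2 fun x => ?_
    obtain ⟨p₂, q₂, p₃, q₃, -, -, h⟩ := symM_fibreH_locally (γ := γ) (ε := ε) hεa hL₀ ha₂ hn b x
    exact ((contDiff_oneSubMulOneSubMul _ 0 p₂ q₂ p₃ q₃).of_le (by exact_mod_cast le_top)).contDiffAt.congr_of_eventuallyEq h

/-- All-orders bounds of the inner profile `1 − g^M(n, · − b)`: `C_r ≥ 0` depending on `r` only, valid for
`ε, ε_a, a₂, L₀ > 0`, `γ ≥ 0`, `0 < b₀` with `b₀·γ ≤ ε_aL₀`. [cite: Grafakos2014, Prop. 3.1.2 (5)] -/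
theorem exists_bound_iteratedDeriv_symM_fibreH (r : ℕ) :
    ∃ C : ℝ, 0 ≤ C ∧ ∀ {γ ε εa a₂ L₀ b₀ : ℝ}, 0 ≤ γ → 0 < ε → 0 < εa → 0 < a₂ → 0 < L₀ → 0 < b₀ → b₀ * γ ≤ εa * L₀ →
      ∀ (n b x : ℝ), |iteratedDeriv r (fun t : ℝ => 1 - smoothTransition ((|n| - L₀) / (ε * L₀)) *
        (1 - smoothTransition ((γ * |t - b + γ * n| - a₂ * |n|) / (εa * L₀)) *
          smoothTransition ((γ * |t - b - γ * n| - a₂ * |n|) / (εa * L₀)))) x| ≤ C / b₀ ^ r := by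
  obtain ⟨C, hC0, hC⟩ := exists_bound_iteratedDeriv_oneSubMulOneSubMul r
  refine ⟨C + 1, by linarith, ?_⟩
  intro γ ε εa a₂ L₀ b₀ hγ hε hεa ha₂ hL₀ hb₀ hb₁ n b x
  have hmono : C / b₀ ^ r ≤ (C + 1) / b₀ ^ r := div_le_div_of_nonneg_right (by linarith) (pow_pos hb₀ r).le
  rcases eq_or_ne n 0 with hn | hn
  · have h0 : smoothTransition ((|n| - L₀) / (ε * L₀)) = 0 :=
      Real.smoothTransition.zero_of_nonpos (div_nonpos_of_nonpos_of_nonneg (by rw [hn, abs_zero]; linarith)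
        (mul_pos hε hL₀).le)
    simp only [h0, zero_mul, sub_zero, iteratedDeriv_const]
    split_ifs with hr
    · subst hr; rw [pow_zero, div_one, abs_one]; linarith
    · rw [abs_zero]; positivity
  · obtain ⟨p₂, q₂, p₃, q₃, hq₂, hq₃, h⟩ := symM_fibreH_locally (γ := γ) (ε := ε) hεa hL₀ ha₂ hn b x
    rw [h.iteratedDeriv_eq]
    refine (hC hb₀ ?_ ?_ ?_ x).trans hmono
    · rw [abs_zero, zero_mul]; exact zero_le_one
    · exact abs_mul_le_one_of_le_div' (mul_pos hεa hL₀) hq₂ hb₀.le (by rwa [abs_of_nonneg hγ])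
    · exact abs_mul_le_one_of_le_div' (mul_pos hεa hL₀) hq₃ hb₀.le (by rwa [abs_of_nonneg hγ])

/-- **`ν_H` is smooth** (`ε, ε_a, L₀, a₂ > 0`). [folklore] -/
theorem contDiff_symM_fibreH_sq {γ ε εa a₂ L₀ : ℝ} (hε : 0 < ε) (hεa : 0 < εa) (hL₀ : 0 < L₀) (ha₂ : 0 < a₂) (n b : ℝ)
    {m : ℕ∞} :
    ContDiff ℝ m (fun t : ℝ => (1 - smoothTransition ((|n| - L₀) / (ε * L₀)) *
        (1 - smoothTransition ((γ * |t - b + γ * n| - a₂ * |n|) / (εa * L₀)) *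
          smoothTransition ((γ * |t - b - γ * n| - a₂ * |n|) / (εa * L₀)))) ^ 2) :=
  (contDiff_symM_fibreH (γ := γ) hε hεa hL₀ ha₂ n b).pow 2

/-- **All-orders Taylor data of `ν_H`** (hypothesis `hT₂` / bounds of `νd` on an H half-slot): for every `r` there is
`C_r ≥ 0` such that for all `ε, ε_a, a₂, L₀ > 0`, `γ ≥ 0`, `0 < b₀` with `b₀·γ ≤ ε_aL₀`, all `n, b ∈ ℤ` and all `t`:
`|((1 − g^M(n, · − b))²)⁽ʳ⁾(t)| ≤ C_r/b₀ʳ`. [cite: Grafakos2014, Prop. 3.1.2 (5)] -/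
theorem exists_bound_iteratedDeriv_symM_fibreH_sq (r : ℕ) :
    ∃ C : ℝ, 0 ≤ C ∧ ∀ {γ ε εa a₂ L₀ b₀ : ℝ}, 0 ≤ γ → 0 < ε → 0 < εa → 0 < a₂ → 0 < L₀ → 0 < b₀ → b₀ * γ ≤ εa * L₀ →
      ∀ (n b : ℤ) (x : ℝ), |iteratedDeriv r (fun t : ℝ => (1 - smoothTransition ((|(n : ℝ)| - L₀) / (ε * L₀)) *
        (1 - smoothTransition ((γ * |t - b + γ * n| - a₂ * |(n : ℝ)|) / (εa * L₀)) *
          smoothTransition ((γ * |t - b - γ * n| - a₂ * |(n : ℝ)|) / (εa * L₀)))) ^ 2) x| ≤ C / b₀ ^ r := by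
  choose C hC0 hC using exists_bound_iteratedDeriv_symM_fibreH
  refine ⟨∑ i ∈ Finset.range (r + 1), (r.choose i : ℝ) * C i * C (r - i),
    Finset.sum_nonneg fun i _ => by have := hC0 i; have := hC0 (r - i); positivity, ?_⟩
  intro γ ε εa a₂ L₀ b₀ hγ hε hεa ha₂ hL₀ hb₀ hb₁ n b x
  exact abs_iteratedDeriv_sq_le_of_scale (contDiff_symM_fibreH (γ := γ) hε hεa hL₀ ha₂ (n : ℝ) (b : ℝ)) hb₀
    (fun i _ y => hC i hγ hε hεa ha₂ hL₀ hb₀ hb₁ (n : ℝ) (b : ℝ) y) x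

/-! ## The envelope profiles (either fibre direction) -/

/-- **Local form of `μ_env`** (`R, w > 0`): near every `x`, `μ_env(t) = 1 − (1 − sT((|n| − R)/w))·(1 − sT((|t| − R)/w))` has the
shape `1 − sT(p₁ + 0·t)·(1 − sT(p₂ + q₂t)·sT(1 + 0·t))` with `|q₂| ≤ 1/w`. [folklore] -/
theorem symEnv_fibre_locally {R w : ℝ} (hR : 0 < R) (hw : 0 < w) (n x : ℝ) :
    ∃ p₁ p₂ q₂ : ℝ, |q₂| ≤ 1 / w ∧
      ((fun t : ℝ => 1 - (1 - smoothTransition ((|n| - R) / w)) * (1 - smoothTransition ((|t| - R) / w))) =ᶠ[𝓝 x]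
        fun t => 1 - smoothTransition (p₁ + 0 * t) *
          (1 - smoothTransition (p₂ + q₂ * t) * smoothTransition (1 + 0 * t))) := by
  obtain ⟨p₁, hp₁⟩ := exists_smoothTransition_eq (c := 1 - smoothTransition ((|n| - R) / w))
    (sub_nonneg.mpr (Real.smoothTransition.le_one _)) (sub_le_self _ (Real.smoothTransition.nonneg _))
  obtain ⟨p₂, q₂, hq₂, h₂⟩ := smoothStep_cone_locally_affine (γ := 1) (γ' := 1) (a₂ := 0) (κ := R) (n' := 0) (x := x)
    hw (Or.inl rfl) (fun _ => by rw [zero_mul, zero_add]; exact hR)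
  refine ⟨p₁, p₂, q₂, by simpa using hq₂, ?_⟩
  filter_upwards [h₂] with t ht₂
  simp only [one_mul, zero_add, zero_mul, sub_zero] at ht₂
  rw [ht₂, zero_mul, add_zero, add_zero, hp₁, Real.smoothTransition.one, mul_one]

/-- **`μ_env` is smooth** (`R, w > 0`). [folklore] -/
theorem contDiff_symEnv_fibre {R w : ℝ} (hR : 0 < R) (hw : 0 < w) (n : ℝ) {m : ℕ∞} :
    ContDiff ℝ m (fun t : ℝ => 1 - (1 - smoothTransition ((|n| - R) / w)) * (1 - smoothTransition ((|t| - R) / w))) := by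
  refine contDiff_iff_contDiffAt.2 fun x => ?_
  obtain ⟨p₁, p₂, q₂, -, h⟩ := symEnv_fibre_locally hR hw n x
  exact ((contDiff_oneSubMulOneSubMul p₁ 0 p₂ q₂ 1 0).of_le (by exact_mod_cast le_top)).contDiffAt.congr_of_eventuallyEq h

/-- **All-orders Taylor data of `μ_env`**: `C_r ≥ 0` depending on `r` only, valid for `R, w > 0`, `0 < b ≤ w`, all `n` and
`t`. [cite: Grafakos2014, Prop. 3.1.2 (5)] -/
theorem exists_bound_iteratedDeriv_symEnv_fibre (r : ℕ) :
    ∃ C : ℝ, 0 ≤ C ∧ ∀ {R w b : ℝ}, 0 < R → 0 < w → 0 < b → b ≤ w → ∀ (n x : ℝ),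
      |iteratedDeriv r (fun t : ℝ => 1 - (1 - smoothTransition ((|n| - R) / w)) *
        (1 - smoothTransition ((|t| - R) / w))) x| ≤ C / b ^ r := by
  obtain ⟨C, hC0, hC⟩ := exists_bound_iteratedDeriv_oneSubMulOneSubMul r
  refine ⟨C, hC0, ?_⟩
  intro R w b hR hw hb hbw n x
  obtain ⟨p₁, p₂, q₂, hq₂, h⟩ := symEnv_fibre_locally hR hw n x
  rw [h.iteratedDeriv_eq]
  refine hC hb ?_ ?_ ?_ x
  · rw [abs_zero, zero_mul]; exact zero_le_one
  · exact abs_mul_le_one_of_le_div' hw hq₂ hb.le (by rwa [mul_one])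
  · rw [abs_zero, zero_mul]; exact zero_le_one

/-- **`ν_env` is smooth**: `(1 − (1 − sT((|n| − R)/w))·(1 − sT((|t − b| − R)/w)))²` (`R, w > 0`). [folklore] -/
theorem contDiff_symEnv_fibre_sq {R w : ℝ} (hR : 0 < R) (hw : 0 < w) (n b : ℝ) {m : ℕ∞} :
    ContDiff ℝ m (fun t : ℝ => (1 - (1 - smoothTransition ((|n| - R) / w)) *
      (1 - smoothTransition ((|t - b| - R) / w))) ^ 2) := by
  have h := (contDiff_symEnv_fibre hR hw n (m := m)).comp ((contDiff_id (𝕜 := ℝ) (E := ℝ)).sub (contDiff_const (c := b)))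
  exact h.pow 2

/-- **All-orders Taylor data of `ν_env`**: `C_r ≥ 0` depending on `r` only, valid for `R, w > 0`, `0 < b₀ ≤ w`, all
`n, b ∈ ℤ` and all `t`. [cite: Grafakos2014, Prop. 3.1.2 (5)] -/
theorem exists_bound_iteratedDeriv_symEnv_fibre_sq (r : ℕ) :
    ∃ C : ℝ, 0 ≤ C ∧ ∀ {R w b₀ : ℝ}, 0 < R → 0 < w → 0 < b₀ → b₀ ≤ w → ∀ (n b : ℤ) (x : ℝ),
      |iteratedDeriv r (fun t : ℝ => (1 - (1 - smoothTransition ((|(n : ℝ)| - R) / w)) *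
        (1 - smoothTransition ((|t - b| - R) / w))) ^ 2) x| ≤ C / b₀ ^ r := by
  choose C hC0 hC using exists_bound_iteratedDeriv_symEnv_fibre
  refine ⟨∑ i ∈ Finset.range (r + 1), (r.choose i : ℝ) * C i * C (r - i),
    Finset.sum_nonneg fun i _ => by have := hC0 i; have := hC0 (r - i); positivity, ?_⟩
  intro R w b₀ hR hw hb₀ hbw n b x
  have hshift : iteratedDeriv r (fun t : ℝ => (1 - (1 - smoothTransition ((|(n : ℝ)| - R) / w)) *
      (1 - smoothTransition ((|t - b| - R) / w))) ^ 2) x =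
      iteratedDeriv r (fun t : ℝ => (1 - (1 - smoothTransition ((|(n : ℝ)| - R) / w)) *
      (1 - smoothTransition ((|t| - R) / w))) ^ 2) (x - b) := by
    rw [iteratedDeriv_comp_sub_const r (fun t : ℝ => (1 - (1 - smoothTransition ((|(n : ℝ)| - R) / w)) *
      (1 - smoothTransition ((|t| - R) / w))) ^ 2) (b : ℝ)]
  rw [hshift]
  exact abs_iteratedDeriv_sq_le_of_scale (contDiff_symEnv_fibre hR hw (n : ℝ)) hb₀
    (fun i _ y => hC i hR hw hb₀ hbw (n : ℝ) y) (x - b)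

end Summit.AnomalousDissipation.AnomalousDissipation.Theorems.SawtoothPulseCascade.K1Cutoff
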